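import Literature.AlgebraicGeometry.Frobenioids.CoprimarySteps
import Literature.AlgebraicGeometry.Frobenioids.PerfFactorialPrimes
import HarnessLib

/-!
# Frobenioids I, Theorem 4.2 (ii), first step: the primes of `Φ(A)` through primary steps —
# two primary steps into `A` define the same prime iff they are not co-primary

Mochizuki, *The geometry of Frobenioids I: the general theory*, Kyushu J. Math. **62** (2008)
293–400, §4, Theorem 4.2 (ii), kurims text pp. 77–78 [cite: MochizukiFrdI2008, Thm. 4.2 (ii) p.77]:
"There exists a unique isomorphism `Ψ^Prime` between the functors `A_i ↦ Prime(Φ_i(A_i))` …" — its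
construction (proof, p. 79: "the map induced by `Ψ` on pre-steps [cf. (i); Theorem 3.4, (ii)]") rests on
the category-theoretic description of the set `Prime(Φ(A))`: by Definition 1.3 (iii)(d) the primary
pre-steps `ε : E → A` correspond to the primary elements `x_ε = ε_*(Div ε)` of `Φ(A)`, and — the point
isolated and PROVED here — two primary steps `ε`, `ι` into `A` give the SAME prime of `Φ(A)` iff they are
NOT co-primary (Prop. 4.1 (iii)). Monoid half (§0 p. 12 primes; Def. 2.4 (i)(b): `Φ(A)_𝔭` monoprime):
two primary elements of a perf-factorial monoid lie in a common prime iff they have a common non-zero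
divisor (`IsPerfFactorial.exists_common_prime_iff`); Frobenioid half: `isCoprimary_iff_forall_dvd`
(`CoprimarySteps.lean`). Standing data: a Frobenioid (`hF`) of isotropic type with `Φ` perf-factorial;
no perfectness is needed for this step. Composition is diagrammatic; monoids multiplicative. No new
definitions.
-/

namespace Literature.AlgebraicGeometry.Frobenioids

open CategoryTheory Opposite

universe w v v' u u'

section Monoid

variable {M : Type w} [CommMonoid M]

/-- A primary element lies in exactly one prime: membership in `𝔭` determines `𝔭`.
[cite: MochizukiFrdI2008, §0 p.12] -/
theorem Primes.eq_of_mem_carrier {𝔭 𝔮 : Primes M} {x : M} (h𝔭 : x ∈ 𝔭.carrier)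
    (h𝔮 : x ∈ 𝔮.carrier) : 𝔭 = 𝔮 := by
  obtain ⟨_, e₁⟩ := h𝔭
  obtain ⟨_, e₂⟩ := h𝔮
  exact e₁.symm.trans e₂

/-- In a perf-factorial monoid (each `M_𝔭` monoprime, Def. 2.4 (i)(b)), two primary elements lie in a
common prime iff they have a common non-zero divisor. [cite: MochizukiFrdI2008, Def. 2.4(i) p.47] -/
theorem IsPerfFactorial.exists_common_prime_iff (h : IsPerfFactorial M) {x y : M} (hx : IsPrimary x)
    (hy : IsPrimary y) :
    (∃ 𝔭 : Primes M, x ∈ 𝔭.carrier ∧ y ∈ 𝔭.carrier) ↔ ∃ z : M, z ≠ 1 ∧ z ∣ x ∧ z ∣ y := by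
  constructor
  · rintro ⟨𝔭, hx𝔭, hy𝔭⟩
    rcases h.dvd_total_of_mem_submonoid 𝔭 (Submonoid.subset_closure hx𝔭)
      (Submonoid.subset_closure hy𝔭) with hxy | hyx
    · exact ⟨x, hx.1, dvd_rfl, hxy⟩
    · exact ⟨y, hy.1, hyx, dvd_rfl⟩
  · rintro ⟨z, hz1, hzx, hzy⟩
    let 𝔭 : Primes M := Quotient.mk (primarySetoid M) ⟨x, hx⟩
    let 𝔮 : Primes M := Quotient.mk (primarySetoid M) ⟨y, hy⟩
    have hx𝔭 : x ∈ 𝔭.carrier := mem_carrier_mk_of_isPrimary hx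
    have hy𝔮 : y ∈ 𝔮.carrier := mem_carrier_mk_of_isPrimary hy
    have hz𝔭 : z ∈ 𝔭.carrier := 𝔭.mem_carrier_of_precsim hx𝔭 hz1 (Precsim.of_dvd hzx)
    have hz𝔮 : z ∈ 𝔮.carrier := 𝔮.mem_carrier_of_precsim hy𝔮 hz1 (Precsim.of_dvd hzy)
    exact ⟨𝔭, hx𝔭, (Primes.eq_of_mem_carrier hz𝔭 hz𝔮) ▸ hy𝔮⟩

end Monoid

namespace PreFrobenioid

variable {D : Type u} [Category.{v} D] {Φ : Dᵒᵖ ⥤ CommMonCat.{w}}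
  {C : Type u'} [Category.{v'} C] {F : C ⥤ ElemFrobenioid Φ}

/-- For a primary pre-step `ε : E → A`, the element `x_ε = ε_*(Div ε) ∈ Φ(A)` is primary (Def. 1.3
(iii)(d); `Base(ε)^*` is an isomorphism of monoids). [cite: MochizukiFrdI2008, Def. 1.3(iii) p.25] -/
theorem isPrimary_invDiv {E A : C} {ε : E ⟶ A} (hε : IsPrimaryPreStep F ε) :
    IsPrimary (invDiv F ε hε.1.2) := by
  haveI : IsIso (Base F ε) := hε.1.2
  exact (isPrimary_pull_iff (Base F ε) _).mp (by rw [pull_invDiv]; exact hε.2)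

/-- **Theorem 4.2 (ii), first step** (FrdI pp. 77–79; Prop. 4.1 (iii); Def. 2.4 (i)(b)): for a
Frobenioid of isotropic type with `Φ` perf-factorial and primary steps `ε : E → A`, `ι : I → A`, the
primary elements `x_ε = ε_*(Div ε)`, `x_ι = ι_*(Div ι)` of `Φ(A)` lie in a COMMON prime of `Φ(A)` iff
`ε`, `ι` are NOT co-primary — so that `Prime(Φ(A))` is the set of primary steps into `A` modulo the
(category-theoretic) relation "not co-primary". [cite: MochizukiFrdI2008, Thm. 4.2 (ii) p.77] -/
theorem exists_common_prime_iff_not_isCoprimary (hF : IsFrobenioid F) (histr : IsOfIsotropicType F)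
    (hpf : Objectwise (fun M _ => IsPerfFactorial M) Φ) {E I A : C} {ε : E ⟶ A} {ι : I ⟶ A}
    (hε : IsPrimaryPreStep F ε) (hι : IsPrimaryPreStep F ι) :
    (∃ 𝔭 : Primes (Φ.obj (op (baseObj F A))),
        invDiv F ε hε.1.2 ∈ 𝔭.carrier ∧ invDiv F ι hι.1.2 ∈ 𝔭.carrier) ↔
      ¬ ∀ ⦃Z : C⦄ (ζ : Z ⟶ A), IsPreStep F ζ →
        (∃ (ε' : E ⟶ Z) (ι' : I ⟶ Z), IsPreStep F ε' ∧ IsPreStep F ι' ∧ ε' ≫ ζ = ε ∧ ι' ≫ ζ = ι) →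
          IsIso ζ := by
  rw [isCoprimary_iff_forall_dvd hF histr hε.1 hι.1,
    (hpf (baseObj F A)).exists_common_prime_iff (isPrimary_invDiv hε) (isPrimary_invDiv hι)]
  constructor
  · rintro ⟨z, hz1, hzε, hzι⟩ hall
    exact hz1 (hall z hzε hzι)
  · intro hn
    by_contra hc
    push Not at hc
    exact hn fun z hzε hzι => by_contra fun hz1 => hc z hz1 hzε hzι

/-- **Theorem 4.2 (ii), first step**, uniqueness half: the prime of `Φ(A)` containing `x_ε` for a primary
pre-step `ε` is unique (and exists: the class of `x_ε`). [cite: MochizukiFrdI2008, Thm. 4.2 (ii) p.77] -/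
theorem existsUnique_prime_invDiv_mem {E A : C} {ε : E ⟶ A} (hε : IsPrimaryPreStep F ε) :
    ∃! 𝔭 : Primes (Φ.obj (op (baseObj F A))), invDiv F ε hε.1.2 ∈ 𝔭.carrier :=
  ⟨Quotient.mk _ ⟨_, isPrimary_invDiv hε⟩, mem_carrier_mk_of_isPrimary (isPrimary_invDiv hε),
    fun _ h => Primes.eq_of_mem_carrier h (mem_carrier_mk_of_isPrimary (isPrimary_invDiv hε))⟩

end PreFrobenioid

end Literature.AlgebraicGeometry.Frobenioids
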